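import Summits.BirchSwinnertonDyer.BirchSwinnertonDyer.Theorems.UniversalToricDescentLocalKummerKernel
import Summits.BirchSwinnertonDyer.BirchSwinnertonDyer.Theorems.UniversalToricDescentKummerLiftPow
import Literature.Barriers.BirchSwinnertonDyer.DescentDefectUnboundedMatsunoCor33Proofs
import HarnessLib

/-!
# Kummer theory at level `p^k` over a subgroup `H ≤ D ≤ Γ_K`: `H¹(H, E[p^k]) ↠ H¹(H, E[p^∞])[p^k]` with kernel
# `E[p^∞]^H / p^k`, and the two-sided count `#H¹(H, E[p^∞])[p^k] ≤ #H¹(H, E[p^k]) ≤ #E[p^∞]^H · #H¹(H, E[p^∞])[p^k]`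
# (crux ♭T≤ stmt-BirchSwinnertonDyer-23042, line `sigmacongruence`, stub TS1′ `stub_twinStrictSurj`, brick (1c±)(c))

Route `UniversalToricDescent`, lead prover `bsd-wall-utd-p1` g17. THEOREMS ONLY (no definition, no named fact, no `sorry`);
`--supports stmt-BirchSwinnertonDyer-23042`. BSD is not proved by any of this.

The level-`p` kernel count of `…LocalKummerKernel` (`natCard_ker_kummer_eq_natCard_quotient`, g13) and the level-`p^k` lift of
`…KummerLiftPow` (`exists_resH1Hom_torsionPow_eq`, g15, for `H ≤ Γ_K`) are here combined at level `p^k` for the NESTED shape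
`H ≤ D ≤ Γ_K` (the layer groups `G_n ≤ D_𝔭′` of the local anticyclotomic tower): verbatim the same cocycle bookkeeping.

* `natCard_ker_kummerPow_eq_natCard_quotient` — `#ker(H¹(H, E[p^k]) → H¹(H, E[p^∞])) = #(E[p^∞]^H / p^k E[p^∞]^H)`;
* `exists_resH1Hom_torsionPow_eq_nested` — every `p^k`-torsion class of `H¹(H, E[p^∞])` lifts to `H¹(H, E[p^k])`;
* `pow_smul_resH1Hom_torsionPow_nested_eq_zero` — the image is killed by `p^k`;
* `kummerPow_twoSided` — for `E[p^∞]^H` and `H¹(H, E[p^k])` finite: `H¹(H, E[p^∞])[p^k]` is finite,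
  `#H¹(H, E[p^k]) ≤ #E[p^∞]^H · #H¹(H, E[p^∞])[p^k]` and `#H¹(H, E[p^∞])[p^k] ≤ #H¹(H, E[p^k])`.

References: [GreenbergLNM1716] §3 proof of Lemma 3.1, §5 p. 114; [SerreGaloisCohomology1997] I §5.1; [GreenbergVatsal2000] §2 p. 25.
-/

set_option autoImplicit false
-- the Theorems namespace of this sub repeats the summit name by design (D-0017 nested layout)
set_option linter.dupNamespace false

noncomputable section

open scoped Classical

namespace Summit.BirchSwinnertonDyer.BirchSwinnertonDyer.Theorems.UniversalToricDescentKummerPow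

open CategoryTheory Field WeierstrassCurve
open Literature.NumberTheory.EllipticCurves Literature.NumberTheory.GaloisRepresentations
  Summit.BirchSwinnertonDyer.BirchSwinnertonDyer.Theorems
open Literature.Barriers.BirchSwinnertonDyer (geomTorsion_pow_le_geomPrimaryTorsion)

variable {K : Type} [Field K] (W : WeierstrassCurve K) [W.IsElliptic] (p : ℕ) [Fact p.Prime]
  {D : Subgroup (absoluteGaloisGroup K)} (H : Subgroup D)

/-! ### §1 The kernel of the level-`p^k` Kummer map -/

/-- **`#ker(H¹(H, E[p^k]) → H¹(H, E[p^∞])) = #(E[p^∞]^H / p^k·E[p^∞]^H)`** for any `H ≤ D ≤ Γ_K` (the level-`p`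
count of `…LocalKummerKernel` at level `p^k`, same proof). [cite: GreenbergLNM1716, §3 proof of Lemma 3.1, §5 p. 114]
[cite: SerreGaloisCohomology1997, I §5.1] -/
theorem natCard_ker_kummerPow_eq_natCard_quotient (k : ℕ) :
    Nat.card ((resH1Hom (ContinuousMonoidHom.id H)
        (AddSubgroup.inclusion (geomTorsion_pow_le_geomPrimaryTorsion W p k)) (fun _ _ ↦ rfl) :
          subgroupH1 H (geomTorsion W ((p ^ k : ℕ) : ℤ)) →+ subgroupH1 H (W.geomPrimaryTorsion p)).ker) =
      Nat.card (FixedPoints.addSubgroup H (W.geomPrimaryTorsion p) ⧸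
        (DistribSMul.toAddMonoidHom (FixedPoints.addSubgroup H (W.geomPrimaryTorsion p)) (p ^ k)).range) := by
  have hdiv : W.zsmul_geomPoints_surjective := W.zsmul_geomPoints_surjective_holds
  set ι : subgroupH1 H (geomTorsion W ((p ^ k : ℕ) : ℤ)) →+ subgroupH1 H (W.geomPrimaryTorsion p) :=
    resH1Hom (ContinuousMonoidHom.id H) (AddSubgroup.inclusion (geomTorsion_pow_le_geomPrimaryTorsion W p k))
      (fun _ _ ↦ rfl) with hιdef
  -- `B = E[p^∞]^G` and multiplication by `p` on it
  set B : AddSubgroup (geomPrimaryTorsion W p) := FixedPoints.addSubgroup H (geomPrimaryTorsion W p) with hB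
  set mulp : B →+ B := DistribSMul.toAddMonoidHom B (p ^ k) with hmulp
  have hmulp_apply : ∀ b : B, mulp b = p ^ k • b := fun _ ↦ rfl
  -- admissible `p`-th roots and their Kummer classes in `H¹(G, E[p])`
  let incl := AddSubgroup.inclusion (geomTorsion_pow_le_geomPrimaryTorsion W p k)
  have hmemB : ∀ (b : geomPrimaryTorsion W p), (∀ σ : H, σ • (p ^ k • b) = p ^ k • b) →
      ∀ σ : H, (((σ • b - b : geomPrimaryTorsion W p)) : geomPoints W) ∈ geomTorsion W ((p ^ k : ℕ) : ℤ) := by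
    intro b hb σ
    refine AddSubgroup.torsionBy.nsmul_iff.mpr ?_
    rw [← AddSubgroupClass.coe_nsmul, smul_sub, smul_comm, hb σ, sub_self, ZeroMemClass.coe_zero]
  let coc : ∀ (b : geomPrimaryTorsion W p), (∀ σ : H, σ • (p ^ k • b) = p ^ k • b) →
      contOneCocycles (discreteTopRep H (geomTorsion W ((p ^ k : ℕ) : ℤ))) := fun b hb ↦
    contOneCocycles.lift incl (fun _ _ ↦ rfl) (AddSubgroup.inclusion_injective _)
      (cobCocycle b (UniversalToricDescentLocalKummer.continuous_smul_sub W p H b)) (fun σ ↦ ⟨_, hmemB b hb σ⟩) (fun _ ↦ rfl)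
  have hcoc : ∀ b hb (σ : H), (((coc b hb).1 σ : geomTorsion W ((p ^ k : ℕ) : ℤ)) : geomPoints W) =
      ((σ • b - b : geomPrimaryTorsion W p) : geomPoints W) := fun _ _ _ ↦ rfl
  -- the class of `coc b` only depends on `b` modulo `B + E[p]`
  have hcls : ∀ (b₁ b₂ : geomPrimaryTorsion W p) (hb₁ : ∀ σ : H, σ • (p ^ k • b₁) = p ^ k • b₁)
      (hb₂ : ∀ σ : H, σ • (p ^ k • b₂) = p ^ k • b₂) (β : geomPrimaryTorsion W p),
      (∀ σ : H, σ • β = β) → p ^ k • (b₁ - b₂ - β) = 0 →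
      oneCocycleClass _ (coc b₁ hb₁) = oneCocycleClass _ (coc b₂ hb₂) := by
    intro b₁ b₂ hb₁ hb₂ β hβ hpe
    have he : (((b₁ - b₂ - β : geomPrimaryTorsion W p)) : geomPoints W) ∈ geomTorsion W ((p ^ k : ℕ) : ℤ) :=
      AddSubgroup.torsionBy.nsmul_iff.mpr (by rw [← AddSubgroupClass.coe_nsmul, hpe, ZeroMemClass.coe_zero])
    rw [← sub_eq_zero, ← oneCocycleClass_sub, oneCocycleClass_eq_zero_iff]
    refine ⟨⟨_, he⟩, fun σ ↦ ?_⟩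
    apply Subtype.ext
    change (((coc b₁ hb₁).1 σ - (coc b₂ hb₂).1 σ : geomTorsion W ((p ^ k : ℕ) : ℤ)) : geomPoints W) = _
    rw [AddSubgroupClass.coe_sub, hcoc b₁ hb₁, hcoc b₂ hb₂, ← AddSubgroupClass.coe_sub]
    change _ = (((σ • (b₁ - b₂ - β) - (b₁ - b₂ - β) : geomPrimaryTorsion W p)) : geomPoints W)
    congr 1
    rw [smul_sub, smul_sub, hβ]
    abel
  -- the class of `coc b` dies under `ι` (it becomes the coboundary of `b`)
  have hιcoc : ∀ b hb, ι (oneCocycleClass _ (coc b hb)) = 0 := by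
    intro b hb
    rw [hιdef, resH1Hom_id_oneCocycleClass, contOneCocycles.push_lift]
    exact oneCocycleClass_cobCocycle b _
  -- every kernel element is the class of an admissible root
  have hker : ∀ x ∈ ι.ker, ∃ b hb, x = oneCocycleClass _ (coc b hb) := by
    intro x hx
    obtain ⟨φ, rfl⟩ := oneCocycleClass_surjective _ x
    rw [AddMonoidHom.mem_ker, hιdef, resH1Hom_id_oneCocycleClass, oneCocycleClass_eq_zero_iff] at hx
    obtain ⟨b, hb⟩ := hx
    have hb' : ∀ σ : H, incl (φ.1 σ) = σ • b - b := fun σ ↦ hb σ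
    have hadm : ∀ σ : H, σ • (p ^ k • b) = p ^ k • b := fun σ ↦ by
      have h1 : p ^ k • (σ • b - b) = 0 := by
        rw [← hb' σ, ← map_nsmul]
        have : p ^ k • φ.1 σ = 0 := Subtype.ext (by
          rw [AddSubgroupClass.coe_nsmul, ZeroMemClass.coe_zero]
          exact AddSubgroup.torsionBy.nsmul_iff.mp (φ.1 σ).2)
        rw [this, map_zero]
      rw [smul_sub, smul_comm, sub_eq_zero] at h1
      exact h1
    refine ⟨b, hadm, congrArg _ (Subtype.ext (ContinuousMap.ext fun σ ↦ ?_))⟩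
    apply AddSubgroup.inclusion_injective (geomTorsion_pow_le_geomPrimaryTorsion W p k)
    change incl (φ.1 σ) = incl ((coc b hadm).1 σ)
    rw [hb' σ]
    rfl
  -- roots of elements of `B`
  have hroot : ∀ β : B, ∃ b : geomPrimaryTorsion W p, p ^ k • b = (β : geomPrimaryTorsion W p) := fun β ↦
    UniversalToricDescentKummerLiftPow.exists_pow_nsmul_eq_geomPrimaryTorsion W p hdiv k _
  choose root hroot using hroot
  have hadm_root : ∀ β : B, ∀ σ : H, σ • (p ^ k • root β) = p ^ k • root β := fun β σ ↦ by
    rw [hroot]; exact β.2 σ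
  -- the homomorphism `θ : B → H¹(G, E[p])`, `β ↦ [∂ root β]`
  have hadd : ∀ β₁ β₂ : B, oneCocycleClass _ (coc (root (β₁ + β₂)) (hadm_root (β₁ + β₂))) =
      oneCocycleClass _ (coc (root β₁) (hadm_root β₁)) + oneCocycleClass _ (coc (root β₂) (hadm_root β₂)) := by
    intro β₁ β₂
    have hsum : ∀ σ : H, σ • (p ^ k • (root β₁ + root β₂)) = p ^ k • (root β₁ + root β₂) := fun σ ↦ by
      rw [smul_add, smul_add, hadm_root, hadm_root]
    have e1 : oneCocycleClass _ (coc (root β₁) (hadm_root β₁)) + oneCocycleClass _ (coc (root β₂) (hadm_root β₂)) =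
        oneCocycleClass _ (coc (root β₁ + root β₂) hsum) := by
      rw [← oneCocycleClass_add]
      congr 1
      apply Subtype.ext; apply ContinuousMap.ext; intro σ
      apply AddSubgroup.inclusion_injective (geomTorsion_pow_le_geomPrimaryTorsion W p k)
      change incl ((coc (root β₁) (hadm_root β₁)).1 σ + (coc (root β₂) (hadm_root β₂)).1 σ) =
        incl ((coc (root β₁ + root β₂) hsum).1 σ)
      rw [map_add]
      change (σ • root β₁ - root β₁) + (σ • root β₂ - root β₂) = σ • (root β₁ + root β₂) - (root β₁ + root β₂)
      rw [smul_add]; abel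
    rw [e1]
    refine hcls _ _ (hadm_root _) hsum 0 (fun σ ↦ smul_zero _) ?_
    rw [sub_zero, smul_sub, hroot, smul_add, hroot, hroot, AddSubgroup.coe_add, sub_self]
  let θ : B →+ subgroupH1 H (geomTorsion W ((p ^ k : ℕ) : ℤ)) :=
    { toFun := fun β ↦ oneCocycleClass _ (coc (root β) (hadm_root β))
      map_zero' := by
        have h0 : ∀ σ : H, σ • (p ^ k • (0 : geomPrimaryTorsion W p)) = p ^ k • (0 : geomPrimaryTorsion W p) :=
          fun σ ↦ by rw [smul_zero, smul_zero]
        have e : oneCocycleClass _ (coc (root 0) (hadm_root 0)) = oneCocycleClass _ (coc 0 h0) :=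
          hcls _ _ (hadm_root 0) h0 0 (fun σ ↦ smul_zero _)
            (by rw [sub_zero, sub_zero, hroot, ZeroMemClass.coe_zero])
        rw [e]
        have hz : coc 0 h0 = 0 := by
          apply Subtype.ext; apply ContinuousMap.ext; intro σ
          apply AddSubgroup.inclusion_injective (geomTorsion_pow_le_geomPrimaryTorsion W p k)
          change σ • (0 : geomPrimaryTorsion W p) - 0 = incl 0
          rw [smul_zero, sub_zero, map_zero]
        rw [hz, oneCocycleClass_zero]
      map_add' := hadd }
  have hθapply : ∀ β : B, θ β = oneCocycleClass _ (coc (root β) (hadm_root β)) := fun _ ↦ rfl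
  -- `range θ = ker ι`
  have hrange : θ.range = ι.ker := by
    ext x
    constructor
    · rintro ⟨β, rfl⟩
      rw [AddMonoidHom.mem_ker, hθapply]
      exact hιcoc _ (hadm_root β)
    · intro hx
      obtain ⟨b, hb, rfl⟩ := hker x hx
      let β : B := ⟨p ^ k • b, fun σ ↦ hb σ⟩
      refine ⟨β, ?_⟩
      rw [hθapply]
      refine hcls _ _ (hadm_root β) hb 0 (fun σ ↦ smul_zero _) ?_
      rw [sub_zero, smul_sub, hroot, sub_self]
  -- `ker θ = pB`
  have hkerθ : θ.ker = mulp.range := by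
    ext β
    rw [AddMonoidHom.mem_ker, hθapply, oneCocycleClass_eq_zero_iff]
    constructor
    · rintro ⟨m, hm⟩
      -- `σ (root β) − root β = σ m − m`: `root β − m` is `G`-fixed and `p (root β − m) = β`
      have hfix : ∀ σ : H, σ • (root β - incl m) = root β - incl m := fun σ ↦ by
        have h := congrArg incl (hm σ)
        change incl ((coc (root β) (hadm_root β)).1 σ) = incl (σ • m - m) at h
        rw [map_sub] at h
        change σ • root β - root β = σ • incl m - incl m at h
        rw [sub_eq_sub_iff_sub_eq_sub] at h
        rw [smul_sub]
        exact h
      refine ⟨⟨root β - incl m, hfix⟩, Subtype.ext ?_⟩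
      rw [hmulp_apply, AddSubgroupClass.coe_nsmul]
      change p ^ k • (root β - incl m) = (β : geomPrimaryTorsion W p)
      have hpm : p ^ k • incl m = 0 := Subtype.ext (by
        rw [AddSubgroupClass.coe_nsmul, ZeroMemClass.coe_zero]
        exact AddSubgroup.torsionBy.nsmul_iff.mp m.2)
      rw [smul_sub, hpm, sub_zero, hroot]
    · rintro ⟨β', rfl⟩
      -- `β = p β'` with `β'` fixed: `root β − β' ∈ E[p]` and `∂ β' = 0`
      have hpe : p ^ k • (root (mulp β') - (β' : geomPrimaryTorsion W p)) = 0 := by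
        rw [smul_sub, hroot, hmulp_apply, AddSubgroupClass.coe_nsmul, sub_self]
      have he : (((root (mulp β') - (β' : geomPrimaryTorsion W p) : geomPrimaryTorsion W p)) : geomPoints W) ∈
          geomTorsion W ((p ^ k : ℕ) : ℤ) :=
        AddSubgroup.torsionBy.nsmul_iff.mpr (by rw [← AddSubgroupClass.coe_nsmul, hpe, ZeroMemClass.coe_zero])
      refine ⟨⟨_, he⟩, fun σ ↦ ?_⟩
      apply AddSubgroup.inclusion_injective (geomTorsion_pow_le_geomPrimaryTorsion W p k)
      change incl ((coc (root (mulp β')) (hadm_root (mulp β'))).1 σ) = incl (σ • _ - _)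
      rw [map_sub]
      change σ • root (mulp β') - root (mulp β') =
        σ • (root (mulp β') - (β' : geomPrimaryTorsion W p)) - (root (mulp β') - (β' : geomPrimaryTorsion W p))
      rw [smul_sub, β'.2 σ]
      abel
  -- count: `B/pB = B/ker θ ≃ range θ = ker ι`
  have e1 : Nat.card (B ⧸ mulp.range) = Nat.card (B ⧸ θ.ker) :=
    Nat.card_congr (QuotientAddGroup.quotientAddEquivOfEq hkerθ.symm).toEquiv
  have e2 : Nat.card (B ⧸ θ.ker) = Nat.card θ.range :=
    Nat.card_congr (QuotientAddGroup.quotientKerEquivRange θ).toEquiv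
  have e3 : Nat.card θ.range = Nat.card ι.ker := by rw [hrange]
  rw [e1, e2, e3]


/-! ### §2 The lift and the two-sided count -/

/-- **Kummer lift at level `p^k` over a subgroup `H ≤ Γ_K`: `H¹(H, E[p^k]) ↠ H¹(H, E[p^∞])[p^k]`.** If `p^k [φ] = 0` then
`p^k φ = ∂a` with `a = p^k b`, and `φ − ∂b` takes values in `E[p^k]`. [cite: GreenbergLNM1716, §5 p. 114] -/
theorem exists_resH1Hom_torsionPow_eq_nested (k : ℕ) {x : subgroupH1 H (W.geomPrimaryTorsion p)}
    (hx : (p ^ k : ℕ) • x = 0) :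
    ∃ y : Literature.NumberTheory.EllipticCurves.subgroupH1 H (WeierstrassCurve.geomTorsion W ((p ^ k : ℕ) : ℤ)),
      resH1Hom (ContinuousMonoidHom.id H)
        (AddSubgroup.inclusion (geomTorsion_pow_le_geomPrimaryTorsion W p k))
        (fun _ _ ↦ rfl) y = x := by
  have hdiv : W.zsmul_geomPoints_surjective := W.zsmul_geomPoints_surjective_holds
  obtain ⟨φ, rfl⟩ := oneCocycleClass_surjective _ x
  have h := oneCocycleClass_smul (discreteTopRep H (W.geomPrimaryTorsion p)) ((p ^ k : ℕ) : ℤ) φ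
  conv at h => rhs; rw [Nat.cast_smul_eq_nsmul, hx]
  obtain ⟨a, ha⟩ := (oneCocycleClass_eq_zero_iff _ _).mp h
  have ha' : ∀ σ : H, (p ^ k : ℕ) • φ.1 σ = σ • a - a := fun σ ↦ by
    rw [← natCast_zsmul]
    exact ha σ
  obtain ⟨b, rfl⟩ := UniversalToricDescentKummerLiftPow.exists_pow_nsmul_eq_geomPrimaryTorsion W p hdiv k a
  set φ' := φ - cobCocycle b (UniversalToricDescentLocalKummer.continuous_smul_sub W p H b) with hφ'
  have hval : ∀ σ : H, (p ^ k : ℕ) • φ'.1 σ = 0 := fun σ ↦ by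
    change (p ^ k : ℕ) • (φ.1 σ - (σ • b - b)) = 0
    rw [smul_sub, ha', smul_sub, smul_comm, sub_self]
  have hmem : ∀ σ : H,
      ((φ'.1 σ : W.geomPrimaryTorsion p) : WeierstrassCurve.geomPoints W) ∈
        WeierstrassCurve.geomTorsion W ((p ^ k : ℕ) : ℤ) := fun σ ↦
    AddSubgroup.torsionBy.nsmul_iff.mpr (by
      rw [← AddSubgroupClass.coe_nsmul, hval σ, ZeroMemClass.coe_zero])
  let χ : contOneCocycles (discreteTopRep H (WeierstrassCurve.geomTorsion W ((p ^ k : ℕ) : ℤ))) :=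
    contOneCocycles.lift
      (AddSubgroup.inclusion (geomTorsion_pow_le_geomPrimaryTorsion W p k))
      (fun _ _ ↦ rfl) (AddSubgroup.inclusion_injective _) φ' (fun σ ↦ ⟨_, hmem σ⟩)
      (fun _ ↦ rfl)
  refine ⟨oneCocycleClass _ χ, ?_⟩
  rw [resH1Hom_id_oneCocycleClass, contOneCocycles.push_lift, hφ', oneCocycleClass_sub,
    oneCocycleClass_cobCocycle, sub_zero]


omit [W.IsElliptic] [Fact (Nat.Prime p)] in
/-- The image of `H¹(H, E[p^k]) → H¹(H, E[p^∞])` is killed by `p^k`. [cite: GreenbergLNM1716, §3 Lemma 3.1] -/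
theorem pow_smul_resH1Hom_torsionPow_nested_eq_zero (k : ℕ)
    (y : subgroupH1 H (WeierstrassCurve.geomTorsion W ((p ^ k : ℕ) : ℤ))) :
    p ^ k • resH1Hom (ContinuousMonoidHom.id H)
        (AddSubgroup.inclusion (geomTorsion_pow_le_geomPrimaryTorsion W p k)) (fun _ _ ↦ rfl) y = 0 := by
  rw [← map_nsmul]
  have hy : p ^ k • y = 0 := by
    obtain ⟨φ, rfl⟩ := oneCocycleClass_surjective _ y
    have h := oneCocycleClass_smul (discreteTopRep H (WeierstrassCurve.geomTorsion W ((p ^ k : ℕ) : ℤ)))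
      ((p ^ k : ℕ) : ℤ) φ
    rw [← Nat.cast_smul_eq_nsmul (R := ℤ), ← h]
    have hφ : ((p ^ k : ℕ) : ℤ) • φ = 0 := by
      apply Subtype.ext; apply ContinuousMap.ext; intro σ
      change ((p ^ k : ℕ) : ℤ) • φ.1 σ = 0
      rw [natCast_zsmul]
      exact Subtype.ext (by
        rw [AddSubgroupClass.coe_nsmul, ZeroMemClass.coe_zero]
        exact AddSubgroup.torsionBy.nsmul_iff.mp (φ.1 σ).2)
    rw [hφ, oneCocycleClass_zero]
  rw [hy, map_zero]

/-- **The two-sided Kummer count at level `p^k`**: with `A = E[p^∞]`, `ι_k : H¹(H, E[p^k]) → H¹(H, A)` onto `H¹(H, A)[p^k]` with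
kernel `A^H/p^k`: if `A^H` and `H¹(H, E[p^k])` are finite then `H¹(H, A)[p^k]` is finite,
`#H¹(H, E[p^k]) ≤ #A^H · #H¹(H, A)[p^k]` and `#H¹(H, A)[p^k] ≤ #H¹(H, E[p^k])`. [cite: GreenbergLNM1716, §3 Lemma 3.1–3.2]
[cite: GreenbergVatsal2000, §2 p. 25] -/
theorem kummerPow_twoSided (k : ℕ) [Finite (FixedPoints.addSubgroup H (W.geomPrimaryTorsion p))]
    [Finite (subgroupH1 H (WeierstrassCurve.geomTorsion W ((p ^ k : ℕ) : ℤ)))] :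
    Finite {x : subgroupH1 H (W.geomPrimaryTorsion p) // p ^ k • x = 0} ∧
    Nat.card (subgroupH1 H (WeierstrassCurve.geomTorsion W ((p ^ k : ℕ) : ℤ))) ≤
      Nat.card (FixedPoints.addSubgroup H (W.geomPrimaryTorsion p)) *
        Nat.card {x : subgroupH1 H (W.geomPrimaryTorsion p) // p ^ k • x = 0} ∧
    Nat.card {x : subgroupH1 H (W.geomPrimaryTorsion p) // p ^ k • x = 0} ≤
      Nat.card (subgroupH1 H (WeierstrassCurve.geomTorsion W ((p ^ k : ℕ) : ℤ))) := by
  set ι : subgroupH1 H (geomTorsion W ((p ^ k : ℕ) : ℤ)) →+ subgroupH1 H (W.geomPrimaryTorsion p) :=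
    resH1Hom (ContinuousMonoidHom.id H) (AddSubgroup.inclusion (geomTorsion_pow_le_geomPrimaryTorsion W p k))
      (fun _ _ ↦ rfl) with hιdef
  -- `range ι = H¹(H, A)[p^k]`
  have e : ι.range ≃ {x : subgroupH1 H (W.geomPrimaryTorsion p) // p ^ k • x = 0} := by
    refine Equiv.subtypeEquivRight fun x ↦ ⟨?_, fun hx ↦ ?_⟩
    · rintro ⟨y, rfl⟩
      exact pow_smul_resH1Hom_torsionPow_nested_eq_zero W p H k y
    · exact exists_resH1Hom_torsionPow_eq_nested W p H k hx
  haveI : Finite ι.range := Finite.of_surjective _ ι.rangeRestrict_surjective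
  have hrange : Nat.card (subgroupH1 H (geomTorsion W ((p ^ k : ℕ) : ℤ))) = Nat.card ι.range * Nat.card ι.ker := by
    rw [AddSubgroup.card_eq_card_quotient_mul_card_addSubgroup ι.ker,
      Nat.card_congr (QuotientAddGroup.quotientKerEquivRange ι).toEquiv]
  have hker : Nat.card ι.ker ≤ Nat.card (FixedPoints.addSubgroup H (W.geomPrimaryTorsion p)) := by
    rw [hιdef, natCard_ker_kummerPow_eq_natCard_quotient W p H k]
    exact Nat.card_le_card_of_surjective _ (QuotientAddGroup.mk_surjective)
  refine ⟨Finite.of_equiv _ e, ?_, ?_⟩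
  · rw [hrange, ← Nat.card_congr e, mul_comm]
    exact Nat.mul_le_mul_right _ hker
  · rw [← Nat.card_congr e, hrange]
    haveI : Finite ι.ker := Finite.of_injective _ Subtype.val_injective
    exact Nat.le_mul_of_pos_right _ Nat.card_pos

end Summit.BirchSwinnertonDyer.BirchSwinnertonDyer.Theorems.UniversalToricDescentKummerPow

end
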